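import Summits.NavierStokesRegularity.NavierStokesRegularity.Theorems.ExtremiserTransienceNearExtremalTransiencePerFlowZoomPackageFlowPrelims
import HarnessLib

/-!
# Route `ExtremiserTransience`, crux `NearExtremalTransiencePerFlow` (stmt-NavierStokesRegularity-26567) —
# LINE g9-β «filament selection» rev 5 §2e, stub T2′ `stub_zoomPackageFlow`, part 2: FLOW-LEVEL COMPACTNESS ALONG A PINNED SEQUENCE

`--supports stmt-NavierStokesRegularity-26567`.  Prover seat ns-net-p2 (g6).  THE STATEMENT (`zoomPackageFlow`, verbatim the Prop
`ZoomPackageFlow` of the crux workfile `Cruxes/NearExtremalTransiencePerFlow/Lines/filament_selection.lean` rev 5 §2e with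
`ZoomCompactFlow` unfolded, over the δ texts of record `MemberSelection.{EfficientTimesData, NearExtremalFamily}` and
`ZoneTransversality.IsViolator`): for a violator flow with efficient-times data there are a subsequence `σ` and constants with
(i) the NS-compatible zoomed slices `y ↦ (Mb n)⁻¹ • u (t n) ((ν/Mb n) • y)` a near-extremal height-1 family (δ's T2, landed
`MemberSelection.stub_zoomPackage`), and (ii) FLOW-LEVEL ZOOM COMPACTNESS: along any centres `y n` and any subsequence `φ`, a further
subsequence of the translated zoomed FLOWS `(τ, z) ↦ (Mb n)⁻¹ • u (t n + (ν/(Mb n)²)(τ − s)) ((ν/Mb n) • (y n + z))` converges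
pointwise at EVERY rescaled time `τ < 0` to a Type-I ancient mild field `W`, with the Type-I pinning `(Mb n)²(T − t n)/ν → −s`.

PROOF (Koch–Nadirashvili–Seregin–Šverák 2009, Lemma 6.1 / proof of Theorem 6.2, in the tree's Type-I form).
1. `aₙ = (Mb n)²(T − t n)/ν ∈ [c₀², 4C²]`: Leray's lower rate (`PerFlow.lerayLowerRate_of_not_extends`) and the Type-I pinning of
   the height bound at near-efficient late times (universality of `κ⋆`, as in `stub_zoomPackage`).  Bolzano–Weierstrass along the
   given subsequence: `aₙ → L ≥ c₀² > 0`; put `s = −L`.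
2. Normalise `ν = 1` (`v(s', x) = ν⁻¹ u(s'/ν, x)`, the pattern of `typeIZoom_unit_viscosity`, copied to keep the explicit formula)
   and zoom `v` at length `cₙ = ν/Mb n`, centre `cₙ yₙ`, with the time origin placed so that rescaled time `τ` is the physical
   time `t n + (ν/(Mb n)²)(τ − s − ηₙ)`: the true vertex `νT` then sits at rescaled time `Bₙ = (aₙ − L) + ηₙ`, and the vanishing
   shifts `ηₙ = max(aₙ − L, 0) − (aₙ − L) + 1/(n+1) → 0` are chosen so that `Bₙ > 0`.  The zoomed flows are classical at unit
   viscosity (`IsClassicalNSSolutionOn.nsRescale_translate_zero`), Oseen-mild between all pairs of times (`typeIZoom_oseen_pairs`,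
   `oseen_smul_stPull`) and obey the rate `√(−τ)‖wₙ(τ)‖ ≤ C` on `(Aₙ, 0)`, `Aₙ → −∞` (the image of the rate window).
3. The tree's compactness in the Type-I-rate Oseen-mild class (`typeIZoom_compactness`, KNSS Lemma 6.1 with the rate only) gives
   a subsequence and a jointly continuous, weakly divergence-free, Oseen-mild `W` with `√(−τ)‖W‖ ≤ C`, `wₙ(τ) → W(τ)` locally
   uniformly at every `τ < 0`; KNSS Prop. 4.1 (`isTypeIAncientMild_of_continuous_oseenMild`) upgrades it to `IsTypeIAncientMild C W`.
4. The flows of the statement are `wₙ(τ + ηₙ)`; the uniform parabolic `1/4`-Hölder modulus of bounded Oseen-mild solutions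
   (`exists_holder_quarter_of_oseenMild`) removes the vanishing shift `ηₙ`.
HONEST FRAMING: compactness/regularity glue about hypothetical Type-I singular flows; nothing about Navier–Stokes regularity or
blow-up is proved; the heart H′ of the line is untouched; no summit is proved by a line.
[cite: KochNadirashviliSereginSverak2009, Lemma 6.1 and proof of Thm 6.2 (arXiv:0709.3599 pp. 11–13); Prop. 4.1 (p. 8)]
-/

noncomputable section

open scoped Topology InnerProductSpace RealInnerProductSpace ENNReal ContDiff
open MeasureTheory Filter Set Metric Function
open Literature.Analysis Literature.Analysis.FluidPDE
open Summit.NavierStokesRegularity.NavierStokesRegularity.Theorems.DepletionLadder.KStar.HalfSpace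
open Summit.NavierStokesRegularity.NavierStokesRegularity.Theorems.NearExtremalTransiencePerFlow.ZoneTransversality
open Summit.NavierStokesRegularity.NavierStokesRegularity.Theorems.NearExtremalTransiencePerFlow.MemberSelection

namespace Summit.NavierStokesRegularity.NavierStokesRegularity.Theorems

set_option linter.dupNamespace false

namespace NearExtremalTransiencePerFlow.FilamentSelection

/-! ### Steps 2–4: flow-level compactness for a pinned sequence of late times -/

/-- **Flow-level Type-I zoom compactness along a pinned sequence of late times.**  Let `(u, p)` be classical on `[0,T) × ℝ³`
(viscosity `ν`), Leray–Hopf from its rapidly decaying datum, with the eventual rate `√(T − t)‖u t x‖ ≤ C√ν`; let `t n ∈ [0, T)`,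
`t n → T`, `Mb n > 0` with `c₁ ≤ (Mb n)²(T − t n)/ν ≤ c₂`, `0 < c₁`, and centres `y n`.  Then along a subsequence `ψ` the numbers
`(Mb n)²(T − t n)/ν` converge to some `−s > 0` and the translated zoomed flows
`(τ, z) ↦ (Mb n)⁻¹ • u (t n + (ν/(Mb n)²)(τ − s)) ((ν/Mb n) • (y n + z))` converge pointwise, at every `τ < 0`, to a Type-I
ancient mild field `W` with constant `C`.
[cite: KochNadirashviliSereginSverak2009, Lemma 6.1 and proof of Thm 6.2 (arXiv:0709.3599 pp. 11–13)] -/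
theorem zoomCompactFlow_of_pinned {C ν T : ℝ} (hC : 0 < C) (hν : 0 < ν) (hT : 0 < T)
    {u : ℝ → EuclideanSpace ℝ (Fin 3) → EuclideanSpace ℝ (Fin 3)} {p : ℝ → EuclideanSpace ℝ (Fin 3) → ℝ}
    (hsol : IsClassicalNSSolutionOn (Set.Ico 0 T) ν 0 u p) (hLH : IsLerayHopfOn T ν 0 (u 0) u)
    (hdec : HasRapidSpatialDecay (u 0))
    (hrate : ∀ᶠ t in 𝓝[<] T, ∀ x, Real.sqrt (T - t) * ‖u t x‖ ≤ C * Real.sqrt ν)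
    {t Mb : ℕ → ℝ} (ht : ∀ n, t n ∈ Set.Ico 0 T) (htT : Tendsto t atTop (𝓝 T)) (hMbpos : ∀ n, 0 < Mb n)
    {c₁ c₂ : ℝ} (hc₁ : 0 < c₁) (hlow : ∀ n, c₁ ≤ Mb n ^ 2 * (T - t n) / ν)
    (hup : ∀ n, Mb n ^ 2 * (T - t n) / ν ≤ c₂) (y : ℕ → EuclideanSpace ℝ (Fin 3)) :
    ∃ (ψ : ℕ → ℕ) (K s : ℝ) (W : ℝ → EuclideanSpace ℝ (Fin 3) → EuclideanSpace ℝ (Fin 3)), StrictMono ψ ∧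
      IsTypeIAncientMild K W ∧ s < 0 ∧
      Tendsto (fun n => Mb (ψ n) ^ 2 * (T - t (ψ n)) / ν) atTop (𝓝 (-s)) ∧
      ∀ τ : ℝ, τ < 0 → ∀ z : EuclideanSpace ℝ (Fin 3),
        Tendsto (fun n => (Mb (ψ n))⁻¹ •
            u (t (ψ n) + ν / Mb (ψ n) ^ 2 * (τ - s)) ((ν / Mb (ψ n)) • (y (ψ n) + z)))
          atTop (𝓝 (W τ z)) := by
  have hν0 : ν ≠ 0 := hν.ne'
  have hνi : 0 < ν⁻¹ := inv_pos.2 hν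
  have hνT : 0 < ν * T := mul_pos hν hT
  have hTt : ∀ n, 0 < T - t n := fun n => sub_pos.2 (ht n).2
  -- ## Step 1: Bolzano–Weierstrass for `aₙ = Mb² (T − tₙ)/ν ∈ [c₁, c₂]`
  set a : ℕ → ℝ := fun n => Mb n ^ 2 * (T - t n) / ν with hadef
  obtain ⟨L, hLmem, ρ, hρ, haρ⟩ := tendsto_subseq_of_bounded (isBounded_Icc c₁ c₂) (x := a)
    (fun n => ⟨hlow n, hup n⟩)
  rw [closure_Icc] at hLmem
  have hL : c₁ ≤ L := hLmem.1
  have hLpos : 0 < L := hc₁.trans_le hL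
  set s : ℝ := -L with hsdef
  have hs : s < 0 := by rw [hsdef]; linarith
  -- ## Step 2a: the viscosity normalisation `v(s', x) = ν⁻¹ u(s'/ν, x)` (explicit, `unitViscosity_oseen_rate`)
  set v : ℝ → EuclideanSpace ℝ (Fin 3) → EuclideanSpace ℝ (Fin 3) := timeRescale ν⁻¹ ν⁻¹ u with hv
  set π : ℝ → EuclideanSpace ℝ (Fin 3) → ℝ := timeRescale ν⁻¹ (ν⁻¹ ^ 2) p with hπ
  have hvapp : ∀ s' x, v s' x = ν⁻¹ • u (ν⁻¹ * s') x := fun _ _ => rfl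
  obtain ⟨hclv, hoseen, hratev⟩ := unitViscosity_oseen_rate hν hT hsol hLH hdec hrate
  -- the rate window `(T', νT)` with `0 < T'`
  obtain ⟨T₀, hT₀T, hT₀⟩ := mem_nhdsLT_iff_exists_Ioo_subset.1 hratev
  set T' : ℝ := max T₀ (ν * T / 2) with hT'def
  have hT'T : T' < ν * T := max_lt hT₀T (by linarith)
  have hT'pos : 0 < T' := lt_of_lt_of_le (by linarith) (le_max_right _ _)
  have hrate' : ∀ s' ∈ Ioo T' (ν * T), ∀ x, Real.sqrt (ν * T - s') * ‖v s' x‖ ≤ C := fun s' hs' x =>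
    hT₀ ⟨lt_of_le_of_lt (le_max_left _ _) hs'.1, hs'.2⟩ x
  -- ## Step 2b: the zoom along `ρ` with the vanishing shifts `η`
  set e : ℕ → ℝ := fun k => a (ρ k) - L with hedef
  have he : Tendsto e atTop (𝓝 0) := by
    have h := haρ.sub_const L
    rw [sub_self] at h
    exact h
  set B : ℕ → ℝ := fun k => max (e k) 0 + 1 / ((k : ℝ) + 1) with hBdef
  set η : ℕ → ℝ := fun k => B k - e k with hηdef
  have hBpos : ∀ k, 0 < B k := fun k => by
    have h1 : (0 : ℝ) < 1 / ((k : ℝ) + 1) := by positivity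
    have h2 : 0 ≤ max (e k) 0 := le_max_right _ _
    simp only [hBdef]; linarith
  have hηpos : ∀ k, 0 < η k := fun k => by
    have h1 : (0 : ℝ) < 1 / ((k : ℝ) + 1) := by positivity
    have h2 : e k ≤ max (e k) 0 := le_max_left _ _
    simp only [hηdef, hBdef]; linarith
  have hη : Tendsto η atTop (𝓝 0) := by
    have h1 : Tendsto (fun k : ℕ => 1 / ((k : ℝ) + 1)) atTop (𝓝 0) := tendsto_one_div_add_atTop_nhds_zero_nat
    have h2 : Tendsto (fun k => max (e k) 0) atTop (𝓝 (max 0 0)) := he.max tendsto_const_nhds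
    rw [max_self] at h2
    have h3 := (h2.add h1).sub he
    simp only [add_zero, sub_zero] at h3
    exact h3
  -- zoom data: length `cc k = ν / Mb`, vertex (in `v`-time) `t1 k`, centre `x0 k`
  set M : ℕ → ℝ := fun k => Mb (ρ k) with hMdef
  set tk : ℕ → ℝ := fun k => t (ρ k) with htkdef
  have hMpos : ∀ k, 0 < M k := fun k => hMbpos _
  have hTtk : ∀ k, 0 < T - tk k := fun k => hTt _
  set cc : ℕ → ℝ := fun k => ν / M k with hccdef
  have hcc : ∀ k, 0 < cc k := fun k => div_pos hν (hMpos k)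
  have hcc2 : ∀ k, cc k ^ 2 = ν ^ 2 / M k ^ 2 := fun k => by rw [hccdef]; simp only; rw [div_pow]
  set t1 : ℕ → ℝ := fun k => ν * tk k - cc k ^ 2 * (s + η k) with ht1def
  set x0 : ℕ → EuclideanSpace ℝ (Fin 3) := fun k => cc k • y (ρ k) with hx0def
  set A : ℕ → ℝ := fun k => (T' - t1 k) / cc k ^ 2 with hAdef
  set w : ℕ → ℝ → EuclideanSpace ℝ (Fin 3) → EuclideanSpace ℝ (Fin 3) :=
    fun k => cc k • stPull (cc k ^ 2) (cc k) (t1 k) (x0 k) v with hwdef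
  set q : ℕ → ℝ → EuclideanSpace ℝ (Fin 3) → ℝ :=
    fun k => cc k ^ 2 • stPull (cc k ^ 2) (cc k) (t1 k) (x0 k) π with hqdef
  have hwapp : ∀ k τ z, w k τ z = cc k • v (t1 k + cc k ^ 2 * τ) (x0 k + cc k • z) := fun _ _ _ => rfl
  -- `a (ρ k) = (νT − ν tk)/cc²`, i.e. `νT − ν tk = cc² · a (ρ k)`
  have hakey : ∀ k, ν * T - ν * tk k = cc k ^ 2 * a (ρ k) := fun k => by
    rw [hcc2]
    simp only [hadef, hMdef, htkdef]
    have hM0 : Mb (ρ k) ≠ 0 := (hMbpos _).ne'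
    field_simp
  -- the physical (`v`-time) images of `A k`, `B k`
  have hphysA : ∀ k, t1 k + cc k ^ 2 * A k = T' := fun k => by
    simp only [hAdef]
    rw [mul_div_cancel₀ _ (pow_ne_zero 2 (hcc k).ne')]
    ring
  have hphysB : ∀ k, t1 k + cc k ^ 2 * B k = ν * T := fun k => by
    have h1 : B k = e k + η k := by simp only [hηdef]; ring
    rw [h1]
    simp only [ht1def, hedef, hsdef]
    have h2 := hakey k
    linear_combination (-1 : ℝ) * h2
  have hphys_lt : ∀ k, ∀ {σ τ : ℝ}, σ < τ → t1 k + cc k ^ 2 * σ < t1 k + cc k ^ 2 * τ :=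
    fun k σ τ h => by have := pow_pos (hcc k) 2; nlinarith
  have hphys : ∀ k, ∀ τ ∈ Ioo (A k) (B k), t1 k + cc k ^ 2 * τ ∈ Ioo T' (ν * T) := fun k τ hτ =>
    ⟨by rw [← hphysA k]; exact hphys_lt k hτ.1, by rw [← hphysB k]; exact hphys_lt k hτ.2⟩
  -- `cc k ^ 2 → 0` (indeed `cc² ≤ ν (T − tk)/c₁`)
  have hcc2le : ∀ k, cc k ^ 2 ≤ ν * (T - tk k) / c₁ := fun k => by
    rw [le_div_iff₀ hc₁]
    have h1 := hlow (ρ k)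
    have h2 : cc k ^ 2 * (Mb (ρ k) ^ 2 * (T - t (ρ k)) / ν) = ν * (T - tk k) := by
      rw [hcc2]; simp only [hMdef, htkdef]
      have hM0 : Mb (ρ k) ≠ 0 := (hMbpos _).ne'
      field_simp
    calc cc k ^ 2 * c₁ ≤ cc k ^ 2 * (Mb (ρ k) ^ 2 * (T - t (ρ k)) / ν) :=
          mul_le_mul_of_nonneg_left h1 (sq_nonneg _)
      _ = ν * (T - tk k) := h2
  have htkT : Tendsto tk atTop (𝓝 T) := htT.comp hρ.tendsto_atTop
  have hcc2lim : Tendsto (fun k => cc k ^ 2) atTop (𝓝 0) := by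
    have h1 : Tendsto (fun k => ν * (T - tk k) / c₁) atTop (𝓝 (ν * (T - T) / c₁)) :=
      ((htkT.const_sub T).const_mul ν).div_const c₁
    rw [sub_self, mul_zero, zero_div] at h1
    exact squeeze_zero (fun k => sq_nonneg _) hcc2le h1
  -- `A k → −∞`
  have hAlim : Tendsto A atTop atBot := by
    -- `A k = (T' − ν tk)/cc² + (s + η k)` with `T' − ν tk ≤ −(νT − T')/2` eventually
    have hA_eq : ∀ k, A k = (T' - ν * tk k) * (cc k ^ 2)⁻¹ + (s + η k) := fun k => by
      simp only [hAdef, ht1def]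
      have hc0 : cc k ≠ 0 := (hcc k).ne'
      rw [div_eq_mul_inv]
      have hi : cc k ^ 2 * (cc k ^ 2)⁻¹ = 1 := mul_inv_cancel₀ (pow_ne_zero 2 hc0)
      linear_combination (s + η k) * hi
    have hδ : 0 < ν * T - T' := sub_pos.2 hT'T
    have hnum : ∀ᶠ k in atTop, T' - ν * tk k ≤ -((ν * T - T') / 2) := by
      have h1 : Tendsto (fun k => T' - ν * tk k) atTop (𝓝 (T' - ν * T)) :=
        tendsto_const_nhds.sub (htkT.const_mul ν)
      have h2 : T' - ν * T < -((ν * T - T') / 2) := by linarith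
      filter_upwards [h1.eventually (gt_mem_nhds h2)] with k hk using hk.le
    have hinv : Tendsto (fun k => (cc k ^ 2)⁻¹) atTop atTop := by
      refine Tendsto.inv_tendsto_nhdsGT_zero ?_
      exact tendsto_nhdsWithin_iff.2 ⟨hcc2lim, Eventually.of_forall fun k => pow_pos (hcc k) 2⟩
    have hmain : Tendsto (fun k => -((ν * T - T') / 2) * (cc k ^ 2)⁻¹) atTop atBot :=
      hinv.const_mul_atTop_of_neg (by linarith)
    have hηbd : ∀ᶠ k in atTop, η k ≤ 1 := hη.eventually (eventually_le_nhds one_pos)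
    have hsum : Tendsto (fun k => (s + η k) + -((ν * T - T') / 2) * (cc k ^ 2)⁻¹) atTop atBot :=
      tendsto_atBot_add_left_of_ge' atTop (s + 1) (by filter_upwards [hηbd] with k hk; linarith) hmain
    refine tendsto_atBot_mono' atTop ?_ hsum
    filter_upwards [hnum] with k hk
    rw [hA_eq k]
    have hi : 0 ≤ (cc k ^ 2)⁻¹ := inv_nonneg.2 (sq_nonneg _)
    nlinarith [mul_le_mul_of_nonneg_right hk hi]
  -- the zoomed fields are classical on `(A k, B k)` at unit viscosity
  have hwcl : ∀ k, IsClassicalNSSolutionOn (Ioo (A k) (B k)) 1 0 (w k) (q k) := by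
    intro k
    have h := hclv.nsRescale_translate_zero (hcc k) (t1 k) (x0 k)
    refine h.mono (fun τ hτ => ?_) isOpen_Ioo.uniqueDiffOn
    have hp := hphys k τ hτ
    exact ⟨(hT'pos.trans hp.1).le, hp.2⟩
  -- the Oseen equation between all times of `(A k, B k)`
  have hwmild : ∀ k, ∀ s₁ t₂ : ℝ, A k < s₁ → s₁ < t₂ → t₂ < B k → ∀ z,
      w k t₂ z = UnboundedOperators.heatExtension (w k s₁) (t₂ - s₁) z -
        oseenDuhamel 1 s₁ (w k) (w k) t₂ z := by
    intro k s₁ t₂ hAs hst htB z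
    refine oseen_smul_stPull (hcc k) (t1 k) (x0 k) hst (fun X => ?_) z
    have hsB : s₁ < B k := hst.trans htB
    have hs' : T' < t1 k + cc k ^ 2 * s₁ := (hphys k s₁ ⟨hAs, hsB⟩).1
    have ht' : t1 k + cc k ^ 2 * t₂ < ν * T := (hphys k t₂ ⟨hAs.trans hst, htB⟩).2
    exact hoseen _ _ (hT'pos.trans hs') (hphys_lt k hst) ht' X
  -- the rate bound on `(A k, 0)`
  have hwI : ∀ k, ∀ τ ∈ Ioo (A k) 0, ∀ z, Real.sqrt (-τ) * ‖w k τ z‖ ≤ C := by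
    intro k τ hτ z
    rw [hwapp]
    have htime : t1 k + cc k ^ 2 * τ ∈ Ioo T' (ν * T) := hphys k τ ⟨hτ.1, hτ.2.trans (hBpos k)⟩
    have hr := hrate' _ htime (x0 k + cc k • z)
    rw [norm_smul, Real.norm_eq_abs, abs_of_pos (hcc k)]
    have hkey : Real.sqrt (-τ) * cc k ≤ Real.sqrt (ν * T - (t1 k + cc k ^ 2 * τ)) := by
      have e1 : Real.sqrt (-τ) * cc k = Real.sqrt (-τ * cc k ^ 2) := by
        rw [Real.sqrt_mul (neg_nonneg.2 hτ.2.le), Real.sqrt_sq (hcc k).le]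
      rw [e1]
      refine Real.sqrt_le_sqrt ?_
      have h1 : ν * T - (t1 k + cc k ^ 2 * τ) = cc k ^ 2 * (B k - τ) := by
        have h0 := hphysB k
        linear_combination (-1 : ℝ) * h0
      rw [h1]
      have := hBpos k
      nlinarith [pow_pos (hcc k) 2]
    calc Real.sqrt (-τ) * (cc k * ‖v (t1 k + cc k ^ 2 * τ) (x0 k + cc k • z)‖)
        = (Real.sqrt (-τ) * cc k) * ‖v (t1 k + cc k ^ 2 * τ) (x0 k + cc k • z)‖ := by ring
      _ ≤ Real.sqrt (ν * T - (t1 k + cc k ^ 2 * τ)) * ‖v (t1 k + cc k ^ 2 * τ) (x0 k + cc k • z)‖ :=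
          mul_le_mul_of_nonneg_right hkey (norm_nonneg _)
      _ ≤ C := hr
  -- ## Step 3: compactness and the Type-I ancient mild limit
  obtain ⟨φ₂, W, hφ₂, hWc, hWdiv, hWI, hWmild, hWconv⟩ :=
    typeIZoom_compactness C A B w q hC hAlim hBpos hwcl hwmild hwI
  have hW : IsTypeIAncientMild C W :=
    isTypeIAncientMild_of_continuous_oseenMild hWc hWdiv hWmild (fun t ht x => by
      rw [le_div_iff₀ (Real.sqrt_pos.2 (neg_pos.2 ht)), mul_comm]
      exact hWI t ht x)
  -- ## Step 4: the flows of the statement are `w k (τ + η k)`; remove the vanishing shift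
  have hident : ∀ k (τ : ℝ) (z : EuclideanSpace ℝ (Fin 3)),
      (Mb (ρ k))⁻¹ • u (t (ρ k) + ν / Mb (ρ k) ^ 2 * (τ - s)) ((ν / Mb (ρ k)) • (y (ρ k) + z))
        = w k (τ + η k) z := by
    intro k τ z
    rw [hwapp, hvapp]
    have hM0 : Mb (ρ k) ≠ 0 := (hMbpos _).ne'
    have e1 : ν⁻¹ * (t1 k + cc k ^ 2 * (τ + η k)) = t (ρ k) + ν / Mb (ρ k) ^ 2 * (τ - s) := by
      simp only [ht1def, hccdef, hMdef, htkdef]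
      field_simp
      ring
    have e2 : x0 k + cc k • z = (ν / Mb (ρ k)) • (y (ρ k) + z) := by
      simp only [hx0def, hccdef, hMdef]
      rw [smul_add]
    have e3 : cc k • (ν⁻¹ • u (ν⁻¹ * (t1 k + cc k ^ 2 * (τ + η k))) (x0 k + cc k • z))
        = (cc k * ν⁻¹) • u (ν⁻¹ * (t1 k + cc k ^ 2 * (τ + η k))) (x0 k + cc k • z) := by
      rw [smul_smul]
    have e4 : cc k * ν⁻¹ = (Mb (ρ k))⁻¹ := by
      simp only [hccdef, hMdef]
      field_simp
    rw [e3, e4, e1, e2]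
  -- the uniform Hölder modulus
  obtain ⟨K₀, hK₀, hHold⟩ := exists_holder_quarter_of_oseenMild (E := EuclideanSpace ℝ (Fin 3))
  refine ⟨fun n => ρ (φ₂ n), C, s, W, hρ.comp hφ₂, hW, hs, ?_, fun τ hτ z => ?_⟩
  · -- the pinning limit along `ρ ∘ φ₂`
    have h := haρ.comp hφ₂.tendsto_atTop
    have e1 : -s = L := by rw [hsdef, neg_neg]
    rw [e1]
    exact h
  · -- convergence at rescaled time `τ < 0`
    have hτ2 : τ / 2 < 0 := by linarith
    -- slices of `w k` are continuous and bounded by `m` on the window `[τ − 2, τ/2]` for large `k`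
    set m : ℝ := C / Real.sqrt (-(τ / 2)) with hmdef
    have hm0 : 0 ≤ m := div_nonneg hC.le (Real.sqrt_nonneg _)
    have hwin : ∀ᶠ k in atTop, A k < τ - 2 ∧ η k ≤ -(τ / 2) ∧ η k ≤ 1 := by
      refine (hAlim.eventually (eventually_lt_atBot (τ - 2))).and ((hη.eventually
        (eventually_le_nhds (by linarith : (0 : ℝ) < -(τ / 2)))).and (hη.eventually (eventually_le_nhds one_pos)))
    have hmod : ∀ᶠ k in atTop, ‖w k (τ + η k) z - w k τ z‖ ≤ K₀ * (m + m ^ 2) * (η k) ^ (1 / 4 : ℝ) := by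
      filter_upwards [hwin] with k hk
      obtain ⟨hAk, hηk, -⟩ := hk
      -- the window `[τ − 2, τ/2] ⊂ (A k, 0)`
      have hIoo : ∀ t' ∈ Icc (τ - 2) (τ / 2), t' ∈ Ioo (A k) (B k) := fun t' ht' =>
        ⟨hAk.trans_le ht'.1, (ht'.2.trans_lt hτ2).trans (hBpos k)⟩
      have hIoo0 : ∀ t' ∈ Icc (τ - 2) (τ / 2), t' ∈ Ioo (A k) 0 := fun t' ht' =>
        ⟨hAk.trans_le ht'.1, ht'.2.trans_lt hτ2⟩
      have hcontk : ContinuousOn (uncurry (w k)) (Ioo (A k) (B k) ×ˢ univ) :=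
        (hwcl k).smooth_velocity.continuousOn
      have hslice : ∀ t' ∈ Icc (τ - 2) (τ / 2), Continuous (w k t') := fun t' ht' =>
        hcontk.comp_continuous (Continuous.prodMk_right t') fun x => ⟨hIoo t' ht', mem_univ x⟩
      have hbd : ∀ t' ∈ Icc (τ - 2) (τ / 2), ∀ x, ‖w k t' x‖ ≤ m := by
        intro t' ht' x
        have h1 := hwI k t' (hIoo0 t' ht') x
        have hst : 0 < Real.sqrt (-t') := Real.sqrt_pos.2 (by linarith [ht'.2])
        have h2 : ‖w k t' x‖ ≤ C / Real.sqrt (-t') := by rw [le_div_iff₀ hst, mul_comm]; exact h1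
        refine h2.trans (div_le_div_of_nonneg_left hC.le (Real.sqrt_pos.2 (by linarith)) ?_)
        exact Real.sqrt_le_sqrt (by linarith [ht'.2])
      have hmildk : ∀ s₁ t₂ : ℝ, τ - 2 ≤ s₁ → s₁ < t₂ → t₂ ≤ τ / 2 → ∀ x,
          w k t₂ x = UnboundedOperators.heatExtension (w k s₁) (t₂ - s₁) x - oseenDuhamel 1 s₁ (w k) (w k) t₂ x :=
        fun s₁ t₂ hs₁ hst ht₂ x => hwmild k s₁ t₂ (hAk.trans_le hs₁) hst ((ht₂.trans_lt hτ2).trans (hBpos k)) x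
      have h := hHold hm0 hslice hbd hmildk τ ⟨by linarith, by linarith⟩ (τ + η k)
        ⟨by linarith [hηpos k], by linarith⟩ z z
      rw [sub_self, norm_zero, add_sub_cancel_left, abs_of_pos (hηpos k), max_eq_left (hηpos k).le] at h
      exact h
    -- the modulus bound tends to `0`
    have hbound0 : Tendsto (fun k => K₀ * (m + m ^ 2) * (η k) ^ (1 / 4 : ℝ)) atTop (𝓝 0) := by
      have h1 : Tendsto (fun k => (η k) ^ (1 / 4 : ℝ)) atTop (𝓝 ((0 : ℝ) ^ (1 / 4 : ℝ))) :=
        hη.rpow_const (Or.inr (by norm_num))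
      rw [Real.zero_rpow (by norm_num)] at h1
      have h2 := h1.const_mul (K₀ * (m + m ^ 2))
      rw [mul_zero] at h2
      exact h2
    -- along `φ₂`
    have hφ₂T : Tendsto φ₂ atTop atTop := hφ₂.tendsto_atTop
    have hdiff : Tendsto (fun n => w (φ₂ n) (τ + η (φ₂ n)) z - w (φ₂ n) τ z) atTop (𝓝 0) :=
      squeeze_zero_norm' (hφ₂T.eventually hmod) (hbound0.comp hφ₂T)
    have hbase : Tendsto (fun n => w (φ₂ n) τ z) atTop (𝓝 (W τ z)) :=
      (tendstoLocallyUniformlyOn_univ.2 (hWconv τ hτ)).tendsto_at (mem_univ _)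
    have hsum := hdiff.add hbase
    rw [zero_add] at hsum
    have e1 : (fun n => (Mb (ρ (φ₂ n)))⁻¹ •
        u (t (ρ (φ₂ n)) + ν / Mb (ρ (φ₂ n)) ^ 2 * (τ - s)) ((ν / Mb (ρ (φ₂ n))) • (y (ρ (φ₂ n)) + z)))
        = fun n => (w (φ₂ n) (τ + η (φ₂ n)) z - w (φ₂ n) τ z) + w (φ₂ n) τ z := by
      funext n
      rw [hident, sub_add_cancel]
    rw [e1]
    exact hsum

end NearExtremalTransiencePerFlow.FilamentSelection

end Summit.NavierStokesRegularity.NavierStokesRegularity.Theorems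

end
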